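import Literature.NumberTheory.LFunctions.Zhang2022.RepairRplus
import Literature.NumberTheory.LFunctions.Zhang2022.KnifeEdgeSmoothClassFlat

/-!
# Zhang (2022) §18-margin repair rung — barrier extension `R⁺⁺`, slice «smooth pieces of ANY length»:
# two decided `DesignFamily`s in the discrete-mean currency (all lengths; top-vanishing full polynomials)

Trunk T-ANT (NumberTheory/LFunctions). Y. Zhang, *Discrete mean estimates and the Landau–Siegel
zero*, arXiv:2211.02515v1 (2022) [Zhang2022LandauSiegel] — **an unrefereed manuscript under
adjudication. WHAT THIS IS NOT: nothing here asserts or denies its Theorems 1–2 or any analytic lemma;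
no claim about Landau–Siegel zeros, about Parity, or about a repaired `Margin232` is made.** Cell
`landau-siegel` (rung F-S3), sub-cell E, stub S-E-p2-1 (iii) of `barrier/ASSIGNMENTS.md` v1.1: the
smooth-top-vanishing slice in the EXTENSION PROTOCOL of `RepairRplus.lean` (p455670: `Repair.DesignFamily`,
`Repair.Rplus`, `Repair.rplus_extend`), on top of the class lemmas `KnifeEdgeSmoothClass.discMeanFlat_lengths` /
`discMeanFlat_topVanishing` (p456962 ← p456650 ← p455698, p446031, p445477).

## The two families (class = regularity only; every conditional input displayed in the verdict)

* `SmoothDesign` `d = (c′, K, M, g)`, class `SmoothDesign.InClass d`: the profile `g : ℝ → ℂ` is `K`-Lipschitz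
  and bounded by `M` ON THE OVERHANG REGION `[1, ∞)` ONLY (nothing is assumed at or below the wall `z = 1`: the
  piece below `P` may be any in-class `H¹` piece, a sum of pieces, …; the class text «`v` 1-Lipschitz,
  `‖v‖∞ ≤ 1` on `[1,θ]`» of OBJECTIVE §1.3 row `R⁺ \ R̄` is the case `K = M = 1`, WITHOUT its clauses
  «`v(1⁺) = u(1⁻)`» and «`v(θ) = 0`», which this currency does not need — a WIDENING, not a narrowing).
  Verdict `SmoothDesign.Verdict d`: for EVERY `0 < ε < δ`, for all large `D` and every real primitive `χ (mod D)`,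
  under the DISPLAYED (A)-world hypothesis `Re ρ = ½` on the sampled zeros (kind (b); Prop. 2.2's output, never
  asserted), for EVERY two lengths `⌈P^{1+ε}⌉ ≤ N₁ ≤ N₂ ≤ ⌈P^{1+δ}⌉`: no main-order gain,
  `¬ (P^{−ε/8}·(discMeanAbs(N₁) + max(K,M)²·discWeight) < |discMean(N₂) − discMean(N₁)|)`
  — `familySmoothLengths`, decided by `familySmoothLengths_decided`.
* `SmoothTopDesign` `d = (c′, K, M, g; θ)`, class: the above AND `g = 0` on `[θ, ∞)` (a smooth TOP-VANISHING
  piece of logarithmic length `θ` — ANY real `θ`). Verdict: for EVERY `ε > 0`, eventually, under the displayed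
  (A)-hypothesis, for EVERY length `N ≥ ⌈P^{1+ε}⌉` (no upper limit — for `N ≥ P^θ` the polynomial is the full
  one): `¬ (P^{−ε/8}·(discMeanAbs(⌈P^{1+ε}⌉) + max(K,M)²·discWeight) < |discMean(N) − discMean(⌈P^{1+ε}⌉)|)`
  — `familySmoothTop`, decided by `familySmoothTop_decided`.

`Repair.profPoly/discMean/discMeanAbs/discWeight` are the bookkeeping `def`s of `RepairRplus.lean`; the bridging
lemmas `discMean_flat_lengths` / `discMean_flat_topVanishing` restate p456962 in that vocabulary (definitional).
C2 (extension, literally): `familyFarPiece` of `Rplus` embeds — `SmoothDesign.ofFarPiece`,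
`inClass_ofFarPiece`, `farPiece_verdict_of_smooth` (its verdict is the case `K = M = 1`, lengths
`N₁ = ⌈P^{1+ε}⌉`, `N₂ = ⌈P^{1+δ}⌉`), `familyFarPiece_decided_of_smooth`. C4 (non-vacuity): the flat profile
`g ≡ 1` (`inClass_flat`), and the clipped overhang parabola `y ↦ φ_θ(min y θ)` of the record's witness
`Repair.phiT θ` (`inClass_phiTop`, every `θ ≥ 1`, e.g. `θ = 21/20`, `5/2`), which is top-vanishing.
Extension: `rplus_smooth_decided : ClassDecided (Rplus ++ [familySmoothLengths, familySmoothTop])`.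
CURRENCY (REF-E C3(e)): discrete mean over the sampled zeros, (A)-hypothesis displayed; NO analytic ⇒ calculus
bridge is stated or used; the band `z ∈ (1, 1+ε]` (registry E-004) is NOT claimed — it is the slot of S-E-p2-2.

## References

* Y. Zhang, arXiv:2211.02515v1 (2022), §2 (2.14)–(2.20), (2.23), §7 (7.2) [p. 44], §8 Lemma 8.1.
  [cite: Zhang2022LandauSiegel, §§2, 7, 8]
-/

noncomputable section

open Real Complex
open scoped NNReal

namespace Literature.NumberTheory.LFunctions.Zhang2022

namespace Repair

/-! ### The class lemmas of p456962 in the `profPoly/discMean` vocabulary (definitional bridge) -/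

/-- `KnifeEdgeSmoothClass.discMeanFlat_lengths` (p456962) with the bookkeeping names of `RepairRplus.lean`:
for `0 < ε < δ`, eventually, under the displayed (A)-hypothesis, for every profile `K`-Lipschitz and bounded by `M`
on `[1, ∞)` and every `⌈P^{1+ε}⌉ ≤ N₁ ≤ N₂ ≤ ⌈P^{1+δ}⌉`:
`|discMean(N₂) − discMean(N₁)| ≤ P^{−ε/8}·(discMeanAbs(N₁) + max(K,M)²·discWeight)`.
[cite: Zhang2022LandauSiegel, §2 (2.16)–(2.20); §8 Lemma 8.1] -/
theorem discMean_flat_lengths (c' : ℝ) {δ ε : ℝ} (hε : 0 < ε) (hεδ : ε < δ) :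
    Skeleton.ForAllLarge fun D _ χ =>
      (∀ i ∈ Skeleton.idx χ, (i.2).re = 1 / 2) →
        ∀ (g : ℝ → ℂ) (K : ℝ≥0) (M : ℝ), LipschitzOnWith K g (Set.Ici 1) →
          (∀ z : ℝ, 1 ≤ z → ‖g z‖ ≤ M) →
          ∀ N₁ N₂ : ℕ, ⌈Skeleton.bigP D ^ (1 + ε)⌉₊ ≤ N₁ → N₁ ≤ N₂ → N₂ ≤ ⌈Skeleton.bigP D ^ (1 + δ)⌉₊ →
            |discMean c' χ g N₂ - discMean c' χ g N₁| ≤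
              Skeleton.bigP D ^ (-(ε / 8)) * (discMeanAbs c' χ g N₁ + max (K : ℝ) M ^ 2 * discWeight c' χ) :=
  KnifeEdgeSmoothClass.discMeanFlat_lengths c' hε hεδ

/-- `KnifeEdgeSmoothClass.discMeanFlat_topVanishing` (p456962) with the bookkeeping names of `RepairRplus.lean`:
for `0 < ε < δ`, eventually, under the displayed (A)-hypothesis, for every profile `K`-Lipschitz and bounded by
`M` on `[1, ∞)` that vanishes on `[θ, ∞)`, `θ ≤ 1 + δ`, and EVERY length `N ≥ ⌈P^{1+ε}⌉`:
`|discMean(N) − discMean(⌈P^{1+ε}⌉)| ≤ P^{−ε/8}·(discMeanAbs(⌈P^{1+ε}⌉) + max(K,M)²·discWeight)`.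
[cite: Zhang2022LandauSiegel, §2 (2.16)–(2.20); §8 Lemma 8.1] -/
theorem discMean_flat_topVanishing (c' : ℝ) {δ ε : ℝ} (hε : 0 < ε) (hεδ : ε < δ) :
    Skeleton.ForAllLarge fun D _ χ =>
      (∀ i ∈ Skeleton.idx χ, (i.2).re = 1 / 2) →
        ∀ (g : ℝ → ℂ) (K : ℝ≥0) (M : ℝ), LipschitzOnWith K g (Set.Ici 1) →
          (∀ z : ℝ, 1 ≤ z → ‖g z‖ ≤ M) →
          ∀ θ : ℝ, θ ≤ 1 + δ → (∀ z, θ ≤ z → g z = 0) →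
            ∀ N : ℕ, ⌈Skeleton.bigP D ^ (1 + ε)⌉₊ ≤ N →
              |discMean c' χ g N - discMean c' χ g ⌈Skeleton.bigP D ^ (1 + ε)⌉₊| ≤
                Skeleton.bigP D ^ (-(ε / 8)) *
                  (discMeanAbs c' χ g ⌈Skeleton.bigP D ^ (1 + ε)⌉₊ + max (K : ℝ) M ^ 2 * discWeight c' χ) :=
  KnifeEdgeSmoothClass.discMeanFlat_topVanishing c' hε hεδ

/-! ### Family «smooth overhang profile, ALL pairs of lengths» -/

/-- A design of the slice: the shift parameter `c′` of the detector weight `𝔠*`, the class constants `K`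
(Lipschitz) and `M` (sup) of the profile on the overhang region `[1, ∞)`, and the profile `g` (in `z = log n/log P`).
[cite: Zhang2022LandauSiegel, §2 (2.23); §7 (7.2) p.44] -/
structure SmoothDesign where
  /-- the shift parameter `c′` of `𝔠*` -/
  c' : ℝ
  /-- Lipschitz constant of the profile on `[1, ∞)` -/
  K : ℝ≥0
  /-- sup bound of the profile on `[1, ∞)` -/
  M : ℝ
  /-- the profile `g(z)`, `z = log n / log P` -/
  g : ℝ → ℂ

/-- **Class predicate** (regularity on the overhang region only; NO analytic hypothesis): `g` is `K`-Lipschitz on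
`[1, ∞)` and `‖g(z)‖ ≤ M` for `z ≥ 1`. [cite: Zhang2022LandauSiegel, §7 (7.2) p.44] -/
def SmoothDesign.InClass (d : SmoothDesign) : Prop :=
  LipschitzOnWith d.K d.g (Set.Ici 1) ∧ ∀ z : ℝ, 1 ≤ z → ‖d.g z‖ ≤ d.M

/-- **Verdict** «no main-order gain between ANY two lengths beyond `P^{1+ε}`», every `0 < ε < δ`, the (A)-world
hypothesis `Re ρ = ½` DISPLAYED (kind (b)), discrete-mean currency.
[cite: Zhang2022LandauSiegel, §2 (2.16)–(2.20); §8 Lemma 8.1] -/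
def SmoothDesign.Verdict (d : SmoothDesign) : Prop :=
  ∀ ⦃δ ε : ℝ⦄, 0 < ε → ε < δ → Skeleton.ForAllLarge fun D _ χ =>
    (∀ i ∈ Skeleton.idx χ, (i.2).re = 1 / 2) →
      ∀ N₁ N₂ : ℕ, ⌈Skeleton.bigP D ^ (1 + ε)⌉₊ ≤ N₁ → N₁ ≤ N₂ → N₂ ≤ ⌈Skeleton.bigP D ^ (1 + δ)⌉₊ →
        ¬ (Skeleton.bigP D ^ (-(ε / 8)) *
              (discMeanAbs d.c' χ d.g N₁ + max (d.K : ℝ) d.M ^ 2 * discWeight d.c' χ) <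
            |discMean d.c' χ d.g N₂ - discMean d.c' χ d.g N₁|)

/-- **The slice theorem** `∀ d, K d → V d` for smooth overhang profiles and all pairs of lengths.
[cite: Zhang2022LandauSiegel, §2 (2.16)–(2.20); §8 Lemma 8.1] -/
theorem SmoothDesign.verdict_of_inClass (d : SmoothDesign) (h : d.InClass) : d.Verdict := by
  intro δ ε hε hεδ
  refine (discMean_flat_lengths d.c' hε hεδ).mono ?_
  intro D _ χ _ _ hflat hA N₁ N₂ hN₁ hN₁₂ hN₂
  exact not_lt.2 (hflat hA d.g d.K d.M h.1 h.2 N₁ N₂ hN₁ hN₁₂ hN₂)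

/-- family «smooth overhang profile of any length, all pairs of lengths, discrete-mean currency».
[cite: Zhang2022LandauSiegel, §2 (2.16)–(2.20); §8 Lemma 8.1] -/
def familySmoothLengths : DesignFamily where
  Design := SmoothDesign
  InClass := SmoothDesign.InClass
  Verdict := SmoothDesign.Verdict

/-- **`familySmoothLengths` is decided.** [cite: Zhang2022LandauSiegel, §2 (2.16)–(2.20); §8 Lemma 8.1] -/
theorem familySmoothLengths_decided : familySmoothLengths.Decided :=
  fun d h => SmoothDesign.verdict_of_inClass d h

/-! ### Family «smooth TOP-VANISHING piece of any length: the full polynomial» -/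

/-- A design of the slice with a declared logarithmic length `θ`: the profile vanishes on `[θ, ∞)`
(top-vanishing; beyond `P^θ` the coefficient polynomial has no terms). [cite: Zhang2022LandauSiegel, §7 (7.2) p.44] -/
structure SmoothTopDesign extends SmoothDesign where
  /-- the logarithmic length `θ` (`len = P^θ`); any real number -/
  θ : ℝ

/-- **Class predicate**: `K`-Lipschitz and bounded by `M` on `[1, ∞)`, and `g = 0` on `[θ, ∞)`.
[cite: Zhang2022LandauSiegel, §7 (7.2) p.44] -/
def SmoothTopDesign.InClass (d : SmoothTopDesign) : Prop :=
  d.toSmoothDesign.InClass ∧ ∀ z : ℝ, d.θ ≤ z → d.g z = 0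

/-- **Verdict** «the FULL polynomial (any length `N ≥ ⌈P^{1+ε}⌉`, no upper limit) gains nothing at main order over
the cut at `⌈P^{1+ε}⌉`», every `ε > 0`, (A)-hypothesis displayed, discrete-mean currency.
[cite: Zhang2022LandauSiegel, §2 (2.16)–(2.20); §8 Lemma 8.1] -/
def SmoothTopDesign.Verdict (d : SmoothTopDesign) : Prop :=
  ∀ ⦃ε : ℝ⦄, 0 < ε → Skeleton.ForAllLarge fun D _ χ =>
    (∀ i ∈ Skeleton.idx χ, (i.2).re = 1 / 2) →
      ∀ N : ℕ, ⌈Skeleton.bigP D ^ (1 + ε)⌉₊ ≤ N →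
        ¬ (Skeleton.bigP D ^ (-(ε / 8)) *
              (discMeanAbs d.c' χ d.g ⌈Skeleton.bigP D ^ (1 + ε)⌉₊ + max (d.K : ℝ) d.M ^ 2 * discWeight d.c' χ) <
            |discMean d.c' χ d.g N - discMean d.c' χ d.g ⌈Skeleton.bigP D ^ (1 + ε)⌉₊|)

/-- **The slice theorem** `∀ d, K d → V d` for smooth top-vanishing pieces of any length (take
`δ = |θ − 1| + 2ε`, so that `ε < δ` and `θ ≤ 1 + δ`). [cite: Zhang2022LandauSiegel, §2 (2.16)–(2.20); §8 Lemma 8.1] -/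
theorem SmoothTopDesign.verdict_of_inClass (d : SmoothTopDesign) (h : d.InClass) : d.Verdict := by
  intro ε hε
  have hεδ : ε < |d.θ - 1| + 2 * ε := by have := abs_nonneg (d.θ - 1); linarith
  have hθ : d.θ ≤ 1 + (|d.θ - 1| + 2 * ε) := by have := le_abs_self (d.θ - 1); linarith
  refine (discMean_flat_topVanishing d.c' hε hεδ).mono ?_
  intro D _ χ _ _ hflat hA N hN
  exact not_lt.2 (hflat hA d.g d.K d.M h.1.1 h.1.2 d.θ hθ h.2 N hN)

/-- family «smooth top-vanishing piece of any length, full polynomial, discrete-mean currency».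
[cite: Zhang2022LandauSiegel, §2 (2.16)–(2.20); §8 Lemma 8.1] -/
def familySmoothTop : DesignFamily where
  Design := SmoothTopDesign
  InClass := SmoothTopDesign.InClass
  Verdict := SmoothTopDesign.Verdict

/-- **`familySmoothTop` is decided.** [cite: Zhang2022LandauSiegel, §2 (2.16)–(2.20); §8 Lemma 8.1] -/
theorem familySmoothTop_decided : familySmoothTop.Decided :=
  fun d h => SmoothTopDesign.verdict_of_inClass d h

/-! ### C2 — `familyFarPiece ⊆ familySmoothLengths` literally (its verdict is the case `K = M = 1`, the two
ceiling lengths) -/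

/-- the embedding of a `farPiece` design `(c′, δ, ε, g)` as a smooth design with class constants `K = M = 1`.
[cite: Zhang2022LandauSiegel, §7 (7.2) p.44] -/
def SmoothDesign.ofFarPiece (p : ℝ × ℝ × ℝ × (ℝ → ℂ)) : SmoothDesign :=
  ⟨p.1, 1, 1, p.2.2.2⟩

/-- a `familyFarPiece` member is a `familySmoothLengths` member (global 1-Lipschitz ⇒ 1-Lipschitz on `[1, ∞)`).
[cite: Zhang2022LandauSiegel, §7 (7.2) p.44] -/
theorem inClass_ofFarPiece {p : ℝ × ℝ × ℝ × (ℝ → ℂ)} (h : familyFarPiece.InClass p) :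
    (SmoothDesign.ofFarPiece p).InClass :=
  ⟨h.2.2.1.lipschitzOnWith, fun z _ => h.2.2.2 z⟩

/-- the smooth-lengths verdict of the embedded design gives back the `familyFarPiece` verdict
(`N₁ = ⌈P^{1+ε}⌉`, `N₂ = ⌈P^{1+δ}⌉`, `max 1 1 ^ 2 = 1`). [cite: Zhang2022LandauSiegel, §2 (2.16)–(2.20)] -/
theorem farPiece_verdict_of_smooth {p : ℝ × ℝ × ℝ × (ℝ → ℂ)} (h : familyFarPiece.InClass p)
    (hV : (SmoothDesign.ofFarPiece p).Verdict) : familyFarPiece.Verdict p := by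
  have hε : 0 < p.2.2.1 := h.1
  have hεδ : p.2.2.1 < p.2.1 := h.2.1
  refine (hV hε hεδ).mono ?_
  intro D _ χ _ _ hflat hA
  have hP1 : 1 ≤ Skeleton.bigP D := by
    rw [Skeleton.bigP]
    exact Real.one_le_exp (pow_nonneg (by rw [Skeleton.ell]; exact Real.log_natCast_nonneg D) 9)
  have hNN : ⌈Skeleton.bigP D ^ (1 + p.2.2.1)⌉₊ ≤ ⌈Skeleton.bigP D ^ (1 + p.2.1)⌉₊ :=
    Nat.ceil_mono (Real.rpow_le_rpow_of_exponent_le hP1 (by linarith))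
  have key := hflat hA _ _ le_rfl hNN le_rfl
  simpa [SmoothDesign.ofFarPiece] using key

/-- hence `familyFarPiece.Decided` also follows from the new family (the old currency is an instance of the new one).
[cite: Zhang2022LandauSiegel, §2 (2.16)–(2.20)] -/
theorem familyFarPiece_decided_of_smooth : familyFarPiece.Decided :=
  fun _ h => farPiece_verdict_of_smooth h ((SmoothDesign.ofFarPiece _).verdict_of_inClass (inClass_ofFarPiece h))

/-! ### C4 — non-vacuity: the flat profile and the clipped overhang parabola `φ_θ(min y θ)` -/

/-- the flat profile `g ≡ 1` is a smooth design for every `c′` (`K = M = 1`). [cite: Zhang2022LandauSiegel, §7 (7.2) p.44] -/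
theorem inClass_flat (c' : ℝ) : (SmoothDesign.mk c' 1 1 fun _ => 1).InClass :=
  ⟨((LipschitzWith.const (1 : ℂ)).weaken zero_le_one).lipschitzOnWith, fun _ _ => by simp⟩

/-- the clipped overhang parabola `y ↦ φ_θ(min y θ) = (min y θ − 1)(θ − min y θ)` (`Repair.phiT θ` on `[0, θ]`,
`0` beyond) is, for `θ ≥ 1`, a smooth TOP-VANISHING design of length `θ` with `K = θ − 1`, `M = (θ − 1)²`
(any `c′`; e.g. `θ = 21/20`, `5/2`). [cite: Zhang2022LandauSiegel, Prop 7.1 p.44, (7.2)] -/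
theorem inClass_phiTop (c' : ℝ) {θ : ℝ} (hθ : 1 ≤ θ) :
    (SmoothTopDesign.mk ⟨c', (θ - 1).toNNReal, (θ - 1) ^ 2, fun y => phiT θ (min y θ)⟩ θ).InClass := by
  have hK : (((θ - 1).toNNReal : ℝ≥0) : ℝ) = θ - 1 := Real.coe_toNNReal _ (by linarith)
  have hval : ∀ y : ℝ, 1 ≤ y → phiT θ (min y θ) = (((min y θ - 1) * (θ - min y θ) : ℝ) : ℂ) :=
    fun y hy => phiT_of_ge (le_min hy hθ)
  refine ⟨⟨?_, ?_⟩, ?_⟩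
  · refine LipschitzOnWith.of_dist_le_mul fun a ha b hb => ?_
    dsimp only
    have ha1 : 1 ≤ a := Set.mem_Ici.mp ha
    have hb1 : 1 ≤ b := Set.mem_Ici.mp hb
    rw [hval a ha1, hval b hb1, dist_eq_norm, ← Complex.ofReal_sub, Complex.norm_real, Real.norm_eq_abs, hK,
      Real.dist_eq]
    have hma1 : 1 ≤ min a θ := le_min ha1 hθ
    have hmaθ : min a θ ≤ θ := min_le_right _ _
    have hmb1 : 1 ≤ min b θ := le_min hb1 hθ
    have hmbθ : min b θ ≤ θ := min_le_right _ _
    have hfac : (min a θ - 1) * (θ - min a θ) - (min b θ - 1) * (θ - min b θ) =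
        (min a θ - min b θ) * (θ + 1 - min a θ - min b θ) := by ring
    rw [hfac, abs_mul]
    have h1 : |min a θ - min b θ| ≤ |a - b| :=
      (abs_min_sub_min_le_max a θ b θ).trans (by rw [sub_self, abs_zero, max_eq_left (abs_nonneg _)])
    have h2 : |θ + 1 - min a θ - min b θ| ≤ θ - 1 := abs_le.2 ⟨by linarith, by linarith⟩
    calc |min a θ - min b θ| * |θ + 1 - min a θ - min b θ| ≤ |a - b| * (θ - 1) :=
          mul_le_mul h1 h2 (abs_nonneg _) (abs_nonneg _)
      _ = (θ - 1) * |a - b| := mul_comm _ _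
  · intro z hz
    dsimp only
    rw [hval z hz, Complex.norm_real, Real.norm_eq_abs]
    have hm1 : 1 ≤ min z θ := le_min hz hθ
    have hmθ : min z θ ≤ θ := min_le_right _ _
    rw [abs_of_nonneg (mul_nonneg (by linarith) (by linarith))]
    nlinarith
  · intro z hz
    show phiT θ (min z θ) = 0
    rw [min_eq_right hz, phiT_of_ge hθ]
    simp

/-! ### The extension `R⁺ ++ [familySmoothLengths, familySmoothTop]` is decided -/

/-- **`R⁺⁺`-step of this slice**: `ClassDecided (Rplus ++ [familySmoothLengths, familySmoothTop])` — the class of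
record extended by the two smooth-any-length families (the running assembly `RepairRplusPlus.lean` appends them).
[cite: Zhang2022LandauSiegel, §2 (2.32)–(2.33); §7 (7.2) p.44] -/
theorem rplus_smooth_decided : ClassDecided (Rplus ++ [familySmoothLengths, familySmoothTop]) :=
  classDecided_append.2
    ⟨rplus_decided, classDecided_cons familySmoothLengths_decided
      (classDecided_cons familySmoothTop_decided classDecided_nil)⟩

end Repair

end Literature.NumberTheory.LFunctions.Zhang2022

namespace Literature.NumberTheory.LFunctions.Zhang2022

namespace Repair

open scoped NNReal

/-! ### C1 — the class text's two-piece design `u ⊕ v` is a member (appended) -/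

/-- **Glue: the §1a two-piece design is a `SmoothTopDesign` member.** For `θ ≥ 1`, ANY bulk `u : ℝ → ℂ` below the
wall (no hypothesis: `H¹`, several pieces, …) and an overhang `v` that is `K`-Lipschitz with `‖v‖ ≤ M` on `[1, θ]` and
vanishes at the top (`v θ = 0`), the glued profile `z ↦ u z` (`z < 1`), `v (min z θ)` (`z ≥ 1`; `= 0` beyond `θ`) is
in the class with constants `K, M` and length `θ`. (The class text «`v` 1-Lipschitz, `‖v‖∞ ≤ 1` on `[1,θ]`,
`v(θ) = 0`» is `K = M = 1`; its continuity clause `v(1⁺) = u(1⁻)` is not needed in this currency.)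
[cite: Zhang2022LandauSiegel, §7 (7.2) p.44] -/
theorem inClass_glue (c' : ℝ) {θ : ℝ} (hθ : 1 ≤ θ) (u v : ℝ → ℂ) {K : ℝ≥0} {M : ℝ}
    (hv : LipschitzOnWith K v (Set.Icc 1 θ)) (hM : ∀ z ∈ Set.Icc 1 θ, ‖v z‖ ≤ M) (htop : v θ = 0) :
    (SmoothTopDesign.mk ⟨c', K, M, fun z => if z < 1 then u z else v (min z θ)⟩ θ).InClass := by
  have hmem : ∀ z : ℝ, 1 ≤ z → min z θ ∈ Set.Icc 1 θ := fun z hz => ⟨le_min hz hθ, min_le_right _ _⟩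
  have hval : ∀ z : ℝ, 1 ≤ z → (if z < 1 then u z else v (min z θ)) = v (min z θ) :=
    fun z hz => if_neg (not_lt.2 hz)
  refine ⟨⟨?_, ?_⟩, ?_⟩
  · refine LipschitzOnWith.of_dist_le_mul fun a ha b hb => ?_
    dsimp only
    have ha1 : 1 ≤ a := Set.mem_Ici.mp ha
    have hb1 : 1 ≤ b := Set.mem_Ici.mp hb
    rw [hval a ha1, hval b hb1]
    refine (hv.dist_le_mul _ (hmem a ha1) _ (hmem b hb1)).trans ?_
    refine mul_le_mul_of_nonneg_left ?_ K.2
    rw [Real.dist_eq, Real.dist_eq]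
    exact (abs_min_sub_min_le_max a θ b θ).trans (by rw [sub_self, abs_zero, max_eq_left (abs_nonneg _)])
  · intro z hz
    dsimp only
    rw [hval z hz]
    exact hM _ (hmem z hz)
  · intro z hz
    show (if z < 1 then u z else v (min z θ)) = 0
    rw [hval z (hθ.trans hz), min_eq_right hz, htop]

/-- hence the verdict of `familySmoothTop` for every such glued design (unbundled form, every hypothesis a binder):
for every `ε > 0`, eventually, under the displayed (A)-hypothesis, the FULL two-piece polynomial (any length
`N ≥ ⌈P^{1+ε}⌉`) gains nothing at main order over its cut at `⌈P^{1+ε}⌉`.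
[cite: Zhang2022LandauSiegel, §2 (2.16)–(2.20); §8 Lemma 8.1] -/
theorem verdict_glue (c' : ℝ) {θ : ℝ} (hθ : 1 ≤ θ) (u v : ℝ → ℂ) {K : ℝ≥0} {M : ℝ}
    (hv : LipschitzOnWith K v (Set.Icc 1 θ)) (hM : ∀ z ∈ Set.Icc 1 θ, ‖v z‖ ≤ M) (htop : v θ = 0) :
    (SmoothTopDesign.mk ⟨c', K, M, fun z => if z < 1 then u z else v (min z θ)⟩ θ).Verdict :=
  SmoothTopDesign.verdict_of_inClass _ (inClass_glue c' hθ u v hv hM htop)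

end Repair

end Literature.NumberTheory.LFunctions.Zhang2022
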